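import Literature.NumberTheory.GaloisRepresentations.SUnitsRestrictedKummer
import Literature.NumberTheory.GaloisRepresentations.ContinuousCohomologyDivisibleSequence
import Literature.NumberTheory.GaloisRepresentations.PPrimaryDevissage
import Literature.NumberTheory.GaloisRepresentations.CoinducedModule
import Literature.GroupTheory.ProfiniteSubquotients
import HarnessLib

/-!
# (H3μ) from the Kummer sequence of the `S`-units: `H²(U, E_S)` `p`-divisible and `H³(U, E_S)[p] = 0`
# ⟹ `H³(U, μ_p) = 0` (Neukirch–Schmidt–Wingberg, proof of (8.3.18) from (8.3.11))

Topic `NumberTheory/GaloisCohomology`; namespace `Literature.NumberTheory.GaloisCohomology`.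
THEOREMS ONLY (no definition, no named fact, no instance, no `sorry`; D-0026).

Lane «PT3-TC» of cell `bsd-eis` (crux `GoodLatticeBDPValue`, stmt-BirchSwinnertonDyer-19032), brick
(A5-α) = the KUMMER-TO-(H3μ) ADAPTER.  Setting: `K` a number field, `S ∋ (v ∣ p)` a set of finite
places, `G_{K,S} = Γ_K ⧸ N_S`, `E_S = 𝒪_{K_S,S}ˣ` the `S`-units of `K_S` as a discrete
`G_{K,S}`-module (`SUnits.sUnitsRestricted K S`, brick (A1)), `ρ₀` a `G_{K,S}`-module structure on
`μ_p = μ_p(K̄)` lifting the Galois action, `U ≤ G_{K,S}` OPEN and fixing `μ_p`, and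
`D := E_S|_U`.  NSW prove (8.3.18) (`cd_p G_S ≤ 2`) by showing `H³(U, μ_p) = 0` from the Kummer
sequence `0 → μ_p → E_S →(p)→ E_S → 0` (exact for `S ⊇ S_p`: brick (A1c),
`SUnits.zsmul_surjective_sUnitsRestricted`, with `E_S[p] = μ_p` of order `p`,
`SUnits.natCard_torsionBy_sUnitsRestricted`, trivial over `U`,
`SUnits.sUnitsRestricted_apply_eq_self_of_mem_torsionBy`) and the two arithmetic inputs
(8.3.11) (iii) «`H²(U, E_S)` is `p`-divisible» and (iv) «`H³(U, E_S)[p] = 0`».  This file is the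
formal version of that one step, with (iii), (iv) as HYPOTHESES (they are the outputs of bricks
(A2)/(A3)/(β2) of the lane):

> **`subsingleton_continuousCohomology_mu_of_sUnits`**: (iii)ₙ `p · Hⁿ(U, D) = Hⁿ(U, D)` and
> (iv)ₙ₊₁ `Hⁿ⁺¹(U, D)[p] = 0` ⟹ `Hⁿ⁺¹(U, μ_p) = 0`; **`subsingleton_H3_mu_of_sUnits`** = the case
> `n = 2`, conclusion `Subsingleton (continuousCohomology 3 (ρ₀.restrict (subgroupIncl U)).toTopRep)`
> token-identical with the ∀-hypothesis of `groupCdLE_two_galoisGroupUnramifiedOutside_of_forall_H3_mu`.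

PROOF.  Greenberg's sequence (5) for the `p`-divisible discrete `U`-module `D`
(`ContinuousCohomologyDivisibleSequence`): `0 → Hⁿ(U,D)/p → Hⁿ⁺¹(U, D[p]) → Hⁿ⁺¹(U,D)[p] → 0`; by
(iii) the map `Hⁿ⁺¹(U, D[p]) → Hⁿ⁺¹(U, D)` is injective
(`smul_H_surjective_iff_Hmap_torsionBy_injective`), by (iv) its image `Hⁿ⁺¹(U,D)[p]`
(`range_Hmap_torsionBy_eq_torsionBy_H`) is zero, so `Hⁿ⁺¹(U, D[p]) = 0`; and `D[p] = E_S[p]` and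
`μ_p|_U` are both TRIVIAL `U`-modules of order `p`, hence have the same cohomology
(`subsingleton_of_trivial_of_card_eq`).

HONEST FRAMING: one step of a textbook proof with its arithmetic inputs as hypotheses; no case of
(H3μ), of Harari 17.13 (a) / 17.14, or of BSD is proved here.

## References
* J. Neukirch, A. Schmidt, K. Wingberg, *Cohomology of Number Fields*, 2nd ed. (2008), (8.3.11)
  (iii), (iv) and the proof of (8.3.18). [NeukirchSchmidtWingberg2008]
* D. Harari, *Galois Cohomology and Class Field Theory* (2020), §17.4 Lemma 17.21 (a), Cor. 17.14.
  [Harari2020]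
* R. Greenberg, *On the structure of certain Galois cohomology groups*, Doc. Math. Extra Vol. Coates
  (2006), §3 B sequence (5) (p. 360). [Greenberg2006]
-/

noncomputable section

open CategoryTheory Function NumberField Field IsDedekindDomain Topology
open scoped NumberField

namespace Literature.NumberTheory.GaloisCohomology

open Literature.NumberTheory.GaloisRepresentations
open Literature.NumberTheory.GaloisRepresentations.DiscreteGaloisModule (mu MuCarrier mu_apply_apply)
open Literature.NumberTheory.GaloisRepresentations.SUnits
open Literature.NumberTheory.IwasawaTheory.Greenberg2016 (Hmap)
open _root_.TopRep _root_.ContRepresentation _root_.ContinuousCohomology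

variable {K : Type} [Field K] [NumberField K]

/-! ### §1. The elements of `Γ_K` above an open `U` fixing `μ_p` fix the `p`-th roots of unity -/

omit [NumberField K] in
/-- **`U` fixes `μ_p` ⟹ every `σ ∈ Γ_K` with `σ N_S ∈ U` fixes every `p`-th root of unity of `K̄`**
(unwinding `ρ₀ (σ N_S) = σ|_{μ_p}`). [cite: NeukirchSchmidtWingberg2008, VIII §3 (proof of (8.3.18))] -/
theorem smul_rootsOfUnity_eq_of_apply_eq {S : Set (HeightOneSpectrum (𝓞 K))} {p : ℕ}
    (ρ₀ : ContinuousRep (GaloisGroupUnramifiedOutside K S) ℤ (MuCarrier K p))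
    (hρ₀ : ∀ (σ : absoluteGaloisGroup K) (v : MuCarrier K p), ρ₀ (toUnramifiedQuot K S σ) v = mu K p σ v)
    {σ : absoluteGaloisGroup K} (hσ : ∀ v : MuCarrier K p, ρ₀ (toUnramifiedQuot K S σ) v = v)
    (ζ : rootsOfUnity p (AlgebraicClosure K)) :
    σ • (ζ : (AlgebraicClosure K)ˣ) = ζ := by
  have h := hσ (MuCarrier.ofRootsOfUnity ζ)
  rw [hρ₀] at h
  have h2 := congrArg MuCarrier.toAdditive h
  rw [mu_apply_apply] at h2
  have h3 : σ • ζ = ζ := congrArg Additive.toMul h2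
  have h4 := congrArg (fun x : rootsOfUnity p (AlgebraicClosure K) => (x : (AlgebraicClosure K)ˣ)) h3
  rwa [absoluteGaloisGroup.coe_smul_rootsOfUnity] at h4

/-! ### §2. `Hⁿ⁺¹(U, μ_p) = 0` from (iii)ₙ and (iv)ₙ₊₁ for `D = E_S|_U` -/

/-- **(H3μ) FROM THE KUMMER SEQUENCE OF THE `S`-UNITS, any degree** (NSW, proof of (8.3.18) from
(8.3.11) (iii), (iv)): `K` a number field, `S ∋ (v ∣ p)`, `ρ₀` a `G_{K,S}`-module structure on `μ_p`
lifting the Galois action, `U ≤ G_{K,S}` open with `ρ₀|_U` trivial, `D := E_S|_U`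
(`(sUnitsRestricted K S).restrict (subgroupIncl U)`).  If (iii)ₙ every class of `Hⁿ(U, D)` is
`p`-divisible and (iv)ₙ₊₁ `Hⁿ⁺¹(U, D)` has no `p`-torsion, then `Hⁿ⁺¹(U, μ_p) = 0`.  (Sequence (5)
`0 → Hⁿ(U,D)/p → Hⁿ⁺¹(U,D[p]) → Hⁿ⁺¹(U,D)[p] → 0` for the `p`-divisible `D`
(`zsmul_surjective_sUnitsRestricted`); `D[p] = E_S[p] ≅ μ_p|_U`, both trivial of order `p`.)
[cite: NeukirchSchmidtWingberg2008, (8.3.11) (iii)–(iv) and proof of (8.3.18)]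
[cite: Harari2020, §17.4 Lemma 17.21 (a)] [cite: Greenberg2006, §3 B (5) p. 360] -/
theorem subsingleton_continuousCohomology_mu_of_sUnits (S : Set (HeightOneSpectrum (𝓞 K))) (p : ℕ)
    [Fact p.Prime] (hSp : ∀ v : HeightOneSpectrum (𝓞 K), ((p : ℕ) : 𝓞 K) ∈ v.asIdeal → v ∈ S)
    (ρ₀ : ContinuousRep (GaloisGroupUnramifiedOutside K S) ℤ (MuCarrier K p))
    (hρ₀ : ∀ (σ : absoluteGaloisGroup K) (v : MuCarrier K p), ρ₀ (toUnramifiedQuot K S σ) v = mu K p σ v)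
    (U : Subgroup (GaloisGroupUnramifiedOutside K S)) (hU : IsOpen (U : Set (GaloisGroupUnramifiedOutside K S)))
    (hfix : ∀ g ∈ U, ∀ v : MuCarrier K p, ρ₀ g v = v) (n : ℕ)
    (hdiv : ∀ y : continuousCohomology n ((sUnitsRestricted K S).restrict (subgroupIncl U)).toTopRep,
      ∃ z : continuousCohomology n ((sUnitsRestricted K S).restrict (subgroupIncl U)).toTopRep, p • z = y)
    (htors : ∀ y : continuousCohomology (n + 1) ((sUnitsRestricted K S).restrict (subgroupIncl U)).toTopRep,
      p • y = 0 → y = 0) :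
    Subsingleton (continuousCohomology (n + 1) (ρ₀.restrict (subgroupIncl U)).toTopRep) := by
  classical
  haveI hp : Fact p.Prime := inferInstance
  haveI : NeZero p := ⟨hp.out.ne_zero⟩
  haveI : NeZero ((p : ℕ) : AlgebraicClosure K) := ⟨Nat.cast_ne_zero.2 hp.out.ne_zero⟩
  haveI := AlgebraicClosure.hasEnoughRootsOfUnity K p
  haveI : TotallyDisconnectedSpace (GaloisGroupUnramifiedOutside K S) :=
    Literature.GroupTheory.ProfiniteSubquotients.totallyDisconnectedSpace_quotient
      (ramificationSubgroup K S) (ramificationSubgroup_isClosed K S)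
  haveI : CompactSpace U := isCompact_iff_compactSpace.mp (Subgroup.isClosed_of_isOpen U hU).isCompact
  -- `D = E_S|_U`, `p`-divisible
  let D := (sUnitsRestricted K S).restrict (subgroupIncl U)
  have hπ : Function.Surjective fun d : Representation.invariants
      ((sUnitsModule K S).toRepresentation.comp (ramificationSubgroup K S).subtype) ↦ (p : ℤ) • d :=
    zsmul_surjective_sUnitsRestricted K S hSp
  -- `D[p]`
  let ρ₁ := D.subrepresentation (Submodule.torsionBy ℤ _ (p : ℤ)) (D.torsionBy_smul_le_comap (p : ℤ))
  -- (iii): `p · Hⁿ(U, D) = Hⁿ(U, D)`, so `Hⁿ⁺¹(U, D[p]) → Hⁿ⁺¹(U, D)` is injective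
  have hinj := (D.smul_H_surjective_iff_Hmap_torsionBy_injective (p : ℤ) hπ n).1 fun c => by
    obtain ⟨z, hz⟩ := hdiv c
    refine ⟨z, ?_⟩
    have e := @Nat.cast_smul_eq_nsmul ℤ (D.H n) _ _ (ContinuousRep.H.instModule D n) p z
    exact e.trans hz
  -- (iv): its image `Hⁿ⁺¹(U, D)[p]` vanishes, hence `Hⁿ⁺¹(U, D[p]) = 0`
  have hrange := D.range_Hmap_torsionBy_eq_torsionBy_H (p : ℤ) hπ (n + 1)
  have hzero : ∀ x : ρ₁.H (n + 1), x = 0 := fun x => by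
    apply hinj
    -- `Hmap x ∈ range = Hⁿ⁺¹(U, D)[p]`, i.e. `p • Hmap x = 0`
    have hx := (SetLike.ext_iff.1 hrange
      (Hmap ρ₁ D (Submodule.torsionBy ℤ _ (p : ℤ)).subtypeL (fun _ _ ↦ rfl) (n + 1) x)).1 ⟨x, rfl⟩
    have e := @Nat.cast_smul_eq_nsmul ℤ (D.H (n + 1)) _ _ (ContinuousRep.H.instModule D (n + 1)) p
      (Hmap ρ₁ D (Submodule.torsionBy ℤ _ (p : ℤ)).subtypeL (fun _ _ ↦ rfl) (n + 1) x)
    have hx' : p • (Hmap ρ₁ D (Submodule.torsionBy ℤ _ (p : ℤ)).subtypeL (fun _ _ ↦ rfl) (n + 1) x) = 0 := by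
      rw [← e]
      exact hx
    rw [map_zero]
    exact htors _ hx'
  have hs : Subsingleton (continuousCohomology (n + 1) ρ₁.toTopRep) :=
    ⟨fun x y => by rw [hzero x, hzero y]⟩
  -- `D[p] = E_S[p]` and `μ_p|_U` are both trivial `U`-modules of order `p`
  have hcard₁ : Nat.card (Submodule.torsionBy ℤ (Representation.invariants
      ((sUnitsModule K S).toRepresentation.comp (ramificationSubgroup K S).subtype)) (p : ℤ)) = p :=
    natCard_torsionBy_sUnitsRestricted K S hSp
  have hcard₂ : Nat.card (MuCarrier K p) = p := by
    change Nat.card (rootsOfUnity p (AlgebraicClosure K)) = p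
    exact HasEnoughRootsOfUnity.natCard_rootsOfUnity _ p
  haveI : Finite (Submodule.torsionBy ℤ (Representation.invariants
      ((sUnitsModule K S).toRepresentation.comp (ramificationSubgroup K S).subtype)) (p : ℤ)) :=
    Nat.finite_of_card_ne_zero (by rw [hcard₁]; exact hp.out.ne_zero)
  haveI : Finite (MuCarrier K p) := Nat.finite_of_card_ne_zero (by rw [hcard₂]; exact hp.out.ne_zero)
  have htriv₁ : ∀ (g : U) (a : Submodule.torsionBy ℤ (Representation.invariants
      ((sUnitsModule K S).toRepresentation.comp (ramificationSubgroup K S).subtype)) (p : ℤ)),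
      ρ₁ g a = a := fun g a => by
    obtain ⟨σ, hσ⟩ := toUnramifiedQuot_surjective K S (g : GaloisGroupUnramifiedOutside K S)
    have hσfix : ∀ v : MuCarrier K p, ρ₀ (toUnramifiedQuot K S σ) v = v := fun v => by
      rw [hσ]
      exact hfix _ g.2 v
    apply Subtype.ext
    change sUnitsRestricted K S (g : GaloisGroupUnramifiedOutside K S) (a : _) = a
    rw [← hσ]
    exact sUnitsRestricted_apply_eq_self_of_mem_torsionBy K S
      (smul_rootsOfUnity_eq_of_apply_eq ρ₀ hρ₀ hσfix) a.2
  have htriv₂ : ∀ (g : U) (v : MuCarrier K p), ρ₀.restrict (subgroupIncl U) g v = v :=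
    fun g v => hfix g.1 g.2 v
  exact subsingleton_of_trivial_of_card_eq ρ₁ (ρ₀.restrict (subgroupIncl U)) htriv₁ htriv₂ hcard₁ hcard₂
    (n + 1) hs

/-- **(H3μ) FROM THE KUMMER SEQUENCE OF THE `S`-UNITS, degree 3** — the shape consumed by
`groupCdLE_two_galoisGroupUnramifiedOutside_of_forall_H3_mu` / `poitouTate_restricted_three_le_of_forall_H3_mu`
(`RestrictedRamificationCdTwoOfH3Mu.lean`) and by `forall_subsingleton_continuousCohomology_mu_of_finite`
(finite `S`): with `D = E_S|_U`, (iii) `∀ y : H²(U, D), ∃ z, p • z = y` and (iv)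
`∀ y : H³(U, D), p • y = 0 → y = 0` give `H³(U, μ_p) = 0`.  NSW: "it suffices to show
`H³(G_S(K′), μ_p) = 0` … this follows from (8.3.11) (iii), (iv) and the Kummer sequence".
[cite: NeukirchSchmidtWingberg2008, proof of (8.3.18); (8.3.11) (iii)–(iv)] [cite: Harari2020, Lemma 17.21 (a)] -/
theorem subsingleton_H3_mu_of_sUnits (S : Set (HeightOneSpectrum (𝓞 K))) (p : ℕ)
    [Fact p.Prime] (hSp : ∀ v : HeightOneSpectrum (𝓞 K), ((p : ℕ) : 𝓞 K) ∈ v.asIdeal → v ∈ S)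
    (ρ₀ : ContinuousRep (GaloisGroupUnramifiedOutside K S) ℤ (MuCarrier K p))
    (hρ₀ : ∀ (σ : absoluteGaloisGroup K) (v : MuCarrier K p), ρ₀ (toUnramifiedQuot K S σ) v = mu K p σ v)
    (U : Subgroup (GaloisGroupUnramifiedOutside K S)) (hU : IsOpen (U : Set (GaloisGroupUnramifiedOutside K S)))
    (hfix : ∀ g ∈ U, ∀ v : MuCarrier K p, ρ₀ g v = v)
    (hdiv : ∀ y : continuousCohomology 2 ((sUnitsRestricted K S).restrict (subgroupIncl U)).toTopRep,
      ∃ z : continuousCohomology 2 ((sUnitsRestricted K S).restrict (subgroupIncl U)).toTopRep, p • z = y)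
    (htors : ∀ y : continuousCohomology 3 ((sUnitsRestricted K S).restrict (subgroupIncl U)).toTopRep,
      p • y = 0 → y = 0) :
    Subsingleton (continuousCohomology 3 (ρ₀.restrict (subgroupIncl U)).toTopRep) :=
  subsingleton_continuousCohomology_mu_of_sUnits S p hSp ρ₀ hρ₀ U hU hfix 2 hdiv htors

end Literature.NumberTheory.GaloisCohomology

end
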